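import Summits.Ventures.HodgeRepro2.BallQuotientCovolume

/-!
# The quotient measure on `Γ\𝔹²` is finite on compact sets

Kernel support for the blind cell pub-hodge-repro2 (seat p2), T5-ID §ID-4(b′).  The covering argument of
`BallQuotientCovolume.lean` (images of finite-measure opens cover; `μ_S (mk '' V) ≤ μ_B (V)`) applies
to every COMPACT subset of the quotient, not only to the whole space: for every fundamental domain `D`
the quotient measure is finite on compacts (a Radon-type measure on the locally compact Hausdorff
quotient), without any compactness hypothesis on `Γ\𝔹²`.
-/

namespace Summit.Ventures.HodgeRepro2.ShimuraData

open MeasureTheory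

variable {K : Type*} [Field K] [NumberField K] [NumberField.IsCMField K]
    {τ₁ : K →+* ℂ} {H : Matrix (Fin 3) (Fin 3) K} {Q : Matrix (Fin 3) (Fin 3) ℂ}
    (hQ : IsFrame K τ₁ H Q) (S : Subgroup (GL (Fin 3) K)) (hS : (S : Set (GL (Fin 3) K)) ⊆ unitaryGroup K H)

/-- **Compact subsets of `Γ\𝔹²` have finite quotient measure** (for every fundamental domain `D`). -/
theorem quotientMeasure_lt_top_of_isCompact {D : Set ball₂} (hD : IsBallFundamentalDomain hQ S hS D)
    {C : Set (ballQuotient hQ S hS)} (hC : IsCompact C) : quotientMeasure hQ S hS D C < ⊤ := by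
  choose V hVo hVz hVfin using exists_isOpen_mem_bergmanBall_lt_top
  have hcov : C ⊆ ⋃ z, ballQuotient.mk hQ S hS '' V z := by
    intro x _
    obtain ⟨z, rfl⟩ := ballQuotient_mk_surjective hQ S hS x
    exact Set.mem_iUnion.mpr ⟨z, z, hVz z, rfl⟩
  obtain ⟨T, hT⟩ := hC.elim_finite_subcover _
    (fun z => (isOpenQuotientMap_ballQuotient_mk hQ S hS).isOpenMap _ (hVo z)) hcov
  have h1 : quotientMeasure hQ S hS D C ≤
      ∑ z ∈ T, quotientMeasure hQ S hS D (ballQuotient.mk hQ S hS '' V z) :=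
    (measure_mono hT).trans (measure_biUnion_finset_le T _)
  refine lt_of_le_of_lt h1 (ENNReal.sum_lt_top.mpr fun z _ => ?_)
  exact lt_of_le_of_lt (quotientMeasure_image_mk_le hQ S hS hD (hVo z).measurableSet) (hVfin z)

/-- The quotient measure is finite on compacts (for every fundamental domain `D`). -/
theorem isFiniteMeasureOnCompacts_quotientMeasure {D : Set ball₂}
    (hD : IsBallFundamentalDomain hQ S hS D) : IsFiniteMeasureOnCompacts (quotientMeasure hQ S hS D) :=
  ⟨fun _ hC => quotientMeasure_lt_top_of_isCompact hQ S hS hD hC⟩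

end Summit.Ventures.HodgeRepro2.ShimuraData
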